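import Mathlib
import Literature.Analysis.FluidPDE.ChoiEtAl2017PeriodicHouLuoKernel
import Literature.Analysis.FluidPDE.ChoiEtAl2017PeriodicHouLuoVelocity
import Literature.Analysis.FluidPDE.ChoiEtAl2017PeriodicHouLuoModes
import HarnessLib

/-!
# Choi–Hou–Kiselev–Luo–Šverák–Yao 2017, §4: the Biot–Savart law `u = Qω` of the periodic HL model
# is `L²`-bounded and `u_x = Hω` is an `L²`-contraction — `‖(Qω)′‖_{L²(0,L)} ≤ ‖ω‖_{L²(0,L)}`

HONEST FRAMING (cell ns-blowup GROUP B «PROFILE SEARCH», zones Z3-b′ / Z8 = the Hou–Luo boundary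
MODEL): **1-D MODEL (Hou–Luo), not Euler/NS.** Proof-only companion of
`ChoiEtAl2017PeriodicHouLuoBlowup.lean` (the model and the fact `choiEtAl2017_periodicHouLuo_blowup`),
`…Velocity.lean` (`(Qω)′ = Q(ω′)`, convolution form) and `…Modes.lean` (the kernel's Fourier
integrals). Source: K. Choi, T. Y. Hou, A. Kiselev, G. Luo, V. Šverák, Y. Yao, Comm. Pure Appl.
Math. **70** (2017) 2218–2243 = arXiv:1407.4776 [ChoiHouKiselevLuoSverakYao2017], §4 p. 11:
"`u_x = Hω(x) = (1/L)∫₀ᴸ ω(y) cot[μ(x−y)] dy`, so the nonlocal velocity `u` is defined by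
`u(x) = Qω(x) := (1/π)∫₀ᴸ ω(y) log|sin[μ(x−y)]| dy`", and §2 p. 6 ("(bkmq)": local well-posedness of
the model, used by the proof of Theorem 1 through UNIQUENESS of smooth solutions — whose energy
estimate needs exactly the `L²` bound of `u_x = Hω` proved here).

## What is proved (no definitions, no named facts; net debt 0)

For `L > 0`, with `ĉ(f)(n) = fourierCoeffOn (0 < L) f n = (1/L)∫₀ᴸ e^{−2πinx/L} f(x) dx`
(Mathlib's window Fourier coefficients) and `Λ = ∫₀ᴸ |log|sin(πz/L)|| dz`:

* `fourierCoeffOn_periodicHLVelocity` — **`Q` is a Fourier multiplier**: for continuous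
  `L`-periodic `ω` and every `n`, `ĉ(Qω)(n) = m_n · ĉ(ω)(n)` with
  `m_n = ∫₀ᴸ (1/π) log|sin(πz/L)| e^{−2πinz/L} dz` (Fubini on the convolution form of `Q`,
  `periodicHLVelocity_eq_conv`, and the translation invariance of `∫₀ᴸ` for periodic integrands);
  `kernelMultiplier_eq` — `m_n = −L/(2π|n|)` for `n ≠ 0` (`integral_{cos,sin}_mode_mul_log_abs_sin`
  of `…Modes.lean`); `norm_kernelMultiplier_le` — `|m_n| ≤ Λ/π` for all `n`;
* `fourierCoeffOn_deriv_periodic` — `ĉ(g′)(n) = (2πin/L)·ĉ(g)(n)` for `L`-periodic `g ∈ C¹`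
  (Mathlib `fourierCoeffOn_of_hasDerivAt`; periodicity kills the boundary term);
* **`integral_sq_deriv_periodicHLVelocity_le`** — for `L`-periodic `ω ∈ C¹`:
  `∫₀ᴸ ((Qω)′)² ≤ ∫₀ᴸ ω²`, i.e. `‖Hω‖_{L²(0,L)} ≤ ‖ω‖_{L²(0,L)}` (Parseval on the window,
  `hasSum_sq_fourierCoeffOn`, with `|ĉ((Qω)′)(n)| = |(2πin/L) m_n ĉ(ω)(n)| = |ĉ(ω)(n)|` for `n ≠ 0`
  and `ĉ((Qω)′)(0) = 0`);
* **`integral_sq_periodicHLVelocity_le`** — for continuous `L`-periodic `ω`: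
  `∫₀ᴸ (Qω)² ≤ (Λ/π)² ∫₀ᴸ ω²`.

These are the two `L²` inputs of the uniqueness (energy) argument for smooth periodic HL
solutions (ROADMAP of the discharge of `choiEtAl2017_periodicHouLuo_blowup`, stage (U)).

WHAT THIS IS NOT: not Euler, not Navier–Stokes; no statement about blow-up — `L²` facts about the
Biot–Savart law of the 1-D periodic wall MODEL. `violates:` none — MODEL.
-/

noncomputable section

open Set Filter Real MeasureTheory intervalIntegral Complex
open _root_.Topology

namespace Literature.Analysis.FluidPDE

namespace ChoiEtAl2017

/-! ### §1 The characters `x ↦ e^{−2πinx/L}` and the window Fourier coefficients -/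

/-- `x ↦ e^{−2πinx/L}` is continuous. [folklore] -/
private theorem continuous_chr (L : ℝ) (n : ℤ) :
    Continuous fun x : ℝ => Complex.exp (((-(2 * π * (n : ℝ) * x / L) : ℝ) : ℂ) * I) :=
  Complex.continuous_exp.comp
    ((Complex.continuous_ofReal.comp (by fun_prop)).mul continuous_const)

/-- `|e^{−2πinx/L}| = 1`. [folklore] -/
private theorem norm_chr (L : ℝ) (n : ℤ) (x : ℝ) :
    ‖Complex.exp (((-(2 * π * (n : ℝ) * x / L) : ℝ) : ℂ) * I)‖ = 1 :=
  Complex.norm_exp_ofReal_mul_I _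

/-- Multiplicativity: `e^{−2πin(y+z)/L} = e^{−2πinz/L} e^{−2πiny/L}`. [folklore] -/
private theorem chr_add (L : ℝ) (n : ℤ) (y z : ℝ) :
    Complex.exp (((-(2 * π * (n : ℝ) * (y + z) / L) : ℝ) : ℂ) * I) =
      Complex.exp (((-(2 * π * (n : ℝ) * z / L) : ℝ) : ℂ) * I) *
        Complex.exp (((-(2 * π * (n : ℝ) * y / L) : ℝ) : ℂ) * I) := by
  rw [← Complex.exp_add]
  congr 1
  push_cast
  ring

/-- Periodicity: `e^{−2πin(x+L)/L} = e^{−2πinx/L}` (`L ≠ 0`). [folklore] -/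
private theorem chr_add_period {L : ℝ} (hL : L ≠ 0) (n : ℤ) (x : ℝ) :
    Complex.exp (((-(2 * π * (n : ℝ) * (x + L) / L) : ℝ) : ℂ) * I) =
      Complex.exp (((-(2 * π * (n : ℝ) * x / L) : ℝ) : ℂ) * I) := by
  have h : ((-(2 * π * (n : ℝ) * (x + L) / L) : ℝ) : ℂ) * I =
      ((-(2 * π * (n : ℝ) * x / L) : ℝ) : ℂ) * I + ((-n : ℤ) : ℂ) * (2 * π * I) := by
    have h1 : -(2 * π * (n : ℝ) * (x + L) / L) =
        -(2 * π * (n : ℝ) * x / L) + (-(n : ℝ)) * (2 * π) := by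
      field_simp
      ring
    rw [h1]
    push_cast
    ring
  rw [h, Complex.exp_add, Complex.exp_int_mul_two_pi_mul_I, mul_one]

/-- The Mathlib character in exponential form: `fourier (−n) (x : AddCircle T) = e^{−2πinx/T}`.
[folklore] -/
private theorem fourier_neg_coe_eq (T : ℝ) (n : ℤ) (x : ℝ) :
    fourier (-n) (x : AddCircle T) =
      Complex.exp (((-(2 * π * (n : ℝ) * x / T) : ℝ) : ℂ) * I) := by
  rw [fourier_coe_apply]
  congr 1
  push_cast
  ring

/-- The window Fourier coefficient written out: `ĉ(f)(n) = (1/L) • ∫₀ᴸ e^{−2πinx/L} f(x) dx`.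
[folklore] -/
private theorem fourierCoeffOn_eq {L : ℝ} (hL : 0 < L) (f : ℝ → ℂ) (n : ℤ) :
    fourierCoeffOn hL f n =
      (1 / L : ℝ) • ∫ x in (0 : ℝ)..L,
        Complex.exp (((-(2 * π * (n : ℝ) * x / L) : ℝ) : ℂ) * I) * f x := by
  rw [fourierCoeffOn_eq_integral]
  have h1 : (1 / (L - 0) : ℝ) = 1 / L := by rw [sub_zero]
  rw [h1]
  congr 1
  refine intervalIntegral.integral_congr fun x _ => ?_
  simp only [fourier_neg_coe_eq, sub_zero, smul_eq_mul]

/-- A continuous function is square integrable on the window `(a, b]`. [folklore] -/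
private theorem memLp_two_Ioc {f : ℝ → ℂ} (hf : Continuous f) (a b : ℝ) :
    MemLp f 2 (volume.restrict (Ioc a b)) := by
  obtain ⟨C, hC⟩ := (isCompact_Icc (a := a) (b := b)).exists_bound_of_continuousOn hf.continuousOn
  have htop : MemLp f ⊤ (volume.restrict (Ioc a b)) := by
    refine memLp_top_of_bound hf.aestronglyMeasurable C ?_
    rw [ae_restrict_iff' measurableSet_Ioc]
    exact Eventually.of_forall fun x hx => hC x (Ioc_subset_Icc_self hx)
  exact htop.mono_exponent le_top

/-- `‖(r : ℂ)‖² = r²`. [folklore] -/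
private theorem norm_ofReal_sq (r : ℝ) : ‖(r : ℂ)‖ ^ 2 = r ^ 2 := by
  rw [Complex.norm_real, Real.norm_eq_abs, sq_abs]

/-! ### §2 Fourier coefficients of the derivative of a periodic function -/

/-- **`ĉ(g′)(n) = (2πin/L)·ĉ(g)(n)`** for an `L`-periodic `g ∈ C¹(ℝ)` (`L > 0`, every `n ∈ ℤ`;
for `n = 0` both sides vanish: `∫₀ᴸ g′ = g(L) − g(0) = 0`). Integration by parts on the window,
the boundary term cancelling by periodicity — the mode-wise form of differentiation used in
"`u_x = Hω`". [cite: ChoiHouKiselevLuoSverakYao2017, §4 p. 11 (eqn_m_hl_u: u_x = Hω)] -/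
theorem fourierCoeffOn_deriv_periodic {L : ℝ} (hL : 0 < L) {g : ℝ → ℝ} (hg : ContDiff ℝ 1 g)
    (hper : Function.Periodic g L) (n : ℤ) :
    fourierCoeffOn hL (fun x => ((deriv g x : ℝ) : ℂ)) n =
      (2 * π * I * n / L) * fourierCoeffOn hL (fun x => ((g x : ℝ) : ℂ)) n := by
  have hd : ∀ x, HasDerivAt g (deriv g x) x := fun x =>
    (hg.differentiable (by norm_num)).differentiableAt.hasDerivAt
  have hg'c : Continuous (deriv g) := hg.continuous_deriv le_rfl
  rcases eq_or_ne n 0 with rfl | hn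
  · -- `n = 0`: `ĉ(g′)(0) = (1/L)(g(L) − g(0)) = 0`
    rw [Int.cast_zero, mul_zero, zero_div, zero_mul, fourierCoeffOn_eq hL]
    have h0 : (∫ x in (0 : ℝ)..L,
        Complex.exp (((-(2 * π * ((0 : ℤ) : ℝ) * x / L) : ℝ) : ℂ) * I) * ((deriv g x : ℝ) : ℂ)) =
        ∫ x in (0 : ℝ)..L, ((deriv g x : ℝ) : ℂ) := by
      refine intervalIntegral.integral_congr fun x _ => ?_
      simp
    rw [h0, intervalIntegral.integral_ofReal,
      intervalIntegral.integral_eq_sub_of_hasDerivAt (fun x _ => hd x) (hg'c.intervalIntegrable _ _)]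
    have hp : g L - g 0 = 0 := by
      have h := hper 0
      rw [zero_add] at h
      rw [h, sub_self]
    rw [hp]
    simp
  · have h := fourierCoeffOn_of_hasDerivAt hL hn (fun x _ => (hd x).ofReal_comp)
      ((Complex.continuous_ofReal.comp hg'c).intervalIntegrable _ _)
    have hp : ((g L : ℝ) : ℂ) - ((g 0 : ℝ) : ℂ) = 0 := by
      have h1 := hper 0
      rw [zero_add] at h1
      rw [h1, sub_self]
    rw [hp, mul_zero, zero_sub] at h
    simp only [Complex.ofReal_zero, sub_zero] at h
    rw [h]
    have hI : (2 * π * I * n : ℂ) ≠ 0 := by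
      have hπ : (π : ℂ) ≠ 0 := by exact_mod_cast Real.pi_ne_zero
      have hn'' : (n : ℂ) ≠ 0 := by exact_mod_cast hn
      exact mul_ne_zero (mul_ne_zero (mul_ne_zero two_ne_zero hπ) Complex.I_ne_zero) hn''
    have hL' : (L : ℂ) ≠ 0 := by exact_mod_cast hL.ne'
    field_simp

/-! ### §3 `Q` is a Fourier multiplier: `ĉ(Qω)(n) = m_n ĉ(ω)(n)` -/

/-- The log kernel `z ↦ log|sin(πz/L)|` is measurable. [folklore] -/
private theorem measurable_logKernel (L : ℝ) :
    Measurable fun z : ℝ => Real.log |Real.sin (π * z / L)| :=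
  Real.measurable_log.comp ((Real.continuous_sin.measurable.comp (by fun_prop)).abs)

/-- A continuous `L`-periodic function is bounded: `∃ M ≥ 0, ∀ y, |g y| ≤ M`. [folklore] -/
private theorem exists_abs_le_of_periodic' {g : ℝ → ℝ} (hg : Continuous g) {L : ℝ} (hL : L ≠ 0)
    (hper : Function.Periodic g L) : ∃ M : ℝ, 0 ≤ M ∧ ∀ y, |g y| ≤ M := by
  obtain ⟨C, hC⟩ := isBounded_iff_forall_norm_le.1 (hper.isBounded_of_continuous hL hg)
  refine ⟨max C 0, le_max_right _ _, fun y => ?_⟩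
  have h := hC (g y) (mem_range_self y)
  rw [Real.norm_eq_abs] at h
  exact h.trans (le_max_left _ _)

/-- A continuous function times the log kernel is integrable on `[0, L]`. [folklore] -/
private theorem intervalIntegrable_mul_logKernel {g : ℝ → ℝ} (hg : Continuous g) (L : ℝ) :
    IntervalIntegrable (fun z => g z * Real.log |Real.sin (π * z / L)|) volume 0 L :=
  (intervalIntegrable_log_abs_sin_phase L 0 L).continuousOn_mul hg.continuousOn

/-- **Translation invariance on the window**: for continuous `L`-periodic `w` (`L > 0`) and every
`z`, `∫₀ᴸ e^{−2πinx/L} w(x − z) dx = e^{−2πinz/L} ∫₀ᴸ e^{−2πiny/L} w(y) dy` (substitute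
`x = y + z`; the integrand `e^{−2πin·/L} w` is `L`-periodic). [folklore] -/
private theorem integral_chr_mul_shift {L : ℝ} (hL : 0 < L) {w : ℝ → ℝ}
    (hper : Function.Periodic w L) (n : ℤ) (z : ℝ) :
    (∫ x in (0 : ℝ)..L,
        Complex.exp (((-(2 * π * (n : ℝ) * x / L) : ℝ) : ℂ) * I) * ((w (x - z) : ℝ) : ℂ)) =
      Complex.exp (((-(2 * π * (n : ℝ) * z / L) : ℝ) : ℂ) * I) *
        ∫ y in (0 : ℝ)..L,
          Complex.exp (((-(2 * π * (n : ℝ) * y / L) : ℝ) : ℂ) * I) * ((w y : ℝ) : ℂ) := by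
  set f : ℝ → ℂ := fun y =>
    Complex.exp (((-(2 * π * (n : ℝ) * (y + z) / L) : ℝ) : ℂ) * I) * ((w y : ℝ) : ℂ) with hf
  have hfper : Function.Periodic f L := by
    intro y
    simp only [hf]
    rw [hper y, show y + L + z = (y + z) + L by ring, chr_add_period hL.ne']
  have h1 : (∫ x in (0 : ℝ)..L,
      Complex.exp (((-(2 * π * (n : ℝ) * x / L) : ℝ) : ℂ) * I) * ((w (x - z) : ℝ) : ℂ)) =
      ∫ x in (0 : ℝ)..L, f (x - z) := by
    refine intervalIntegral.integral_congr fun x _ => ?_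
    simp only [hf, sub_add_cancel]
  rw [h1, intervalIntegral.integral_comp_sub_right f z, zero_sub]
  have h2 := hfper.intervalIntegral_add_eq (-z) 0
  rw [zero_add, show -z + L = L - z by ring] at h2
  rw [h2]
  have h3 : (∫ y in (0 : ℝ)..L, f y) = ∫ y in (0 : ℝ)..L,
      Complex.exp (((-(2 * π * (n : ℝ) * z / L) : ℝ) : ℂ) * I) *
        (Complex.exp (((-(2 * π * (n : ℝ) * y / L) : ℝ) : ℂ) * I) * ((w y : ℝ) : ℂ)) := by
    refine intervalIntegral.integral_congr fun y _ => ?_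
    simp only [hf]
    rw [chr_add, mul_assoc]
  rw [h3, intervalIntegral.integral_const_mul]

/-- **`Q` is a Fourier multiplier on the window.** For `L > 0`, a continuous `L`-periodic `ω` and
every `n ∈ ℤ`:
`ĉ(Qω)(n) = m_n · ĉ(ω)(n)`, `m_n = ∫₀ᴸ (1/π) log|sin(πz/L)| e^{−2πinz/L} dz`
— the Fourier-side content of "`u_x = Hω` … so `u = Qω`" (p. 11): Fubini on the convolution form
`Qω(x) = (1/π)∫₀ᴸ ω(x−z) log|sin(πz/L)| dz` and translation invariance of the window integral.
[cite: ChoiHouKiselevLuoSverakYao2017, §4 p. 11 (eqn_m_hl_u: u_x = Hω, u = Qω)] -/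
theorem fourierCoeffOn_periodicHLVelocity {L : ℝ} (hL : 0 < L) {ω : ℝ → ℝ} (hω : Continuous ω)
    (hper : Function.Periodic ω L) (n : ℤ) :
    fourierCoeffOn hL (fun x => ((periodicHLVelocity L ω x : ℝ) : ℂ)) n =
      (∫ z in (0 : ℝ)..L, (((1 / π * Real.log |Real.sin (π * z / L)|) : ℝ) : ℂ) *
          Complex.exp (((-(2 * π * (n : ℝ) * z / L) : ℝ) : ℂ) * I)) *
        fourierCoeffOn hL (fun x => ((ω x : ℝ) : ℂ)) n := by
  -- notation: the character `e` and the kernel `k`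
  set e : ℝ → ℂ := fun x => Complex.exp (((-(2 * π * (n : ℝ) * x / L) : ℝ) : ℂ) * I) with he
  set k : ℝ → ℝ := fun z => Real.log |Real.sin (π * z / L)| with hk
  have hec : Continuous e := continuous_chr L n
  have hkint : IntervalIntegrable k volume 0 L := intervalIntegrable_log_abs_sin_phase L 0 L
  obtain ⟨M, hM0, hM⟩ := exists_abs_le_of_periodic' hω hL.ne' hper
  rw [fourierCoeffOn_eq hL, fourierCoeffOn_eq hL, Complex.real_smul, Complex.real_smul]
  show ((1 / L : ℝ) : ℂ) * (∫ x in (0 : ℝ)..L, e x * ((periodicHLVelocity L ω x : ℝ) : ℂ)) =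
    (∫ z in (0 : ℝ)..L, (((1 / π * k z) : ℝ) : ℂ) * e z) *
      (((1 / L : ℝ) : ℂ) * ∫ x in (0 : ℝ)..L, e x * ((ω x : ℝ) : ℂ))
  -- Step 1: the convolution form inside the coefficient
  have hconv : ∀ x, ((periodicHLVelocity L ω x : ℝ) : ℂ) =
      ∫ z in (0 : ℝ)..L, (((1 / π * (ω (x - z) * k z)) : ℝ) : ℂ) := by
    intro x
    rw [periodicHLVelocity_eq_conv hL hper x, ← intervalIntegral.integral_const_mul,
      intervalIntegral.integral_ofReal]
  -- the two-variable integrand and its integrability on the square `(0,L]²`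
  set F : ℝ → ℝ → ℂ := fun x z => e x * (((1 / π * (ω (x - z) * k z)) : ℝ) : ℂ) with hF
  have hFm : AEStronglyMeasurable (Function.uncurry F)
      ((volume.restrict (Ioc 0 L)).prod (volume.restrict (Ioc 0 L))) := by
    refine Measurable.aestronglyMeasurable ?_
    refine Measurable.mul (hec.measurable.comp measurable_fst) ?_
    refine Complex.measurable_ofReal.comp ?_
    refine Measurable.const_mul (Measurable.mul ?_ ?_) _
    · exact hω.measurable.comp (measurable_fst.sub measurable_snd)
    · exact (measurable_logKernel L).comp measurable_snd
  have hFint : Integrable (Function.uncurry F)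
      ((volume.restrict (Ioc 0 L)).prod (volume.restrict (Ioc 0 L))) := by
    have hg : Integrable (fun p : ℝ × ℝ => (M / π) * |k p.2|)
        ((volume.restrict (Ioc 0 L)).prod (volume.restrict (Ioc 0 L))) := by
      have h1 : Integrable (fun _ : ℝ => M / π) (volume.restrict (Ioc 0 L)) := integrable_const _
      have h2 : Integrable (fun z : ℝ => |k z|) (volume.restrict (Ioc 0 L)) := hkint.abs.1
      exact h1.mul_prod h2
    refine hg.mono' hFm (ae_of_all _ fun p => ?_)
    simp only [Function.uncurry, hF, he, norm_mul, Complex.norm_exp_ofReal_mul_I, one_mul,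
      Complex.norm_real, Real.norm_eq_abs]
    rw [abs_of_pos (show (0 : ℝ) < 1 / π by positivity)]
    have h := hM (p.1 - p.2)
    have hk0 : 0 ≤ |k p.2| := abs_nonneg _
    calc 1 / π * (|ω (p.1 - p.2)| * |k p.2|) ≤ 1 / π * (M * |k p.2|) := by gcongr
      _ = M / π * |k p.2| := by ring
  -- Step 2: Fubini
  have hswap : (∫ x in (0 : ℝ)..L, e x * ((periodicHLVelocity L ω x : ℝ) : ℂ)) =
      ∫ z in (0 : ℝ)..L, ∫ x in (0 : ℝ)..L, F x z := by
    have h1 : (∫ x in (0 : ℝ)..L, e x * ((periodicHLVelocity L ω x : ℝ) : ℂ)) =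
        ∫ x in (0 : ℝ)..L, ∫ z in (0 : ℝ)..L, F x z := by
      refine intervalIntegral.integral_congr fun x _ => ?_
      simp only [hF]
      rw [hconv x, ← intervalIntegral.integral_const_mul]
    rw [h1]
    simp only [intervalIntegral.integral_of_le hL.le]
    exact MeasureTheory.integral_integral_swap hFint
  -- Step 3: the inner `x`-integral by translation invariance
  have hinner : ∀ z, (∫ x in (0 : ℝ)..L, F x z) =
      (((1 / π * k z) : ℝ) : ℂ) * (e z * ∫ y in (0 : ℝ)..L, e y * ((ω y : ℝ) : ℂ)) := by
    intro z
    have h1 : (∫ x in (0 : ℝ)..L, F x z) =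
        ∫ x in (0 : ℝ)..L, (((1 / π * k z) : ℝ) : ℂ) * (e x * ((ω (x - z) : ℝ) : ℂ)) := by
      refine intervalIntegral.integral_congr fun x _ => ?_
      simp only [hF]
      push_cast
      ring
    rw [h1, intervalIntegral.integral_const_mul]
    simp only [he]
    rw [integral_chr_mul_shift hL hper n z]
  rw [hswap]
  simp_rw [hinner]
  set C : ℂ := ∫ y in (0 : ℝ)..L, e y * ((ω y : ℝ) : ℂ) with hC
  have hCout : (∫ z in (0 : ℝ)..L, (((1 / π * k z) : ℝ) : ℂ) * (e z * C)) =
      (∫ z in (0 : ℝ)..L, (((1 / π * k z) : ℝ) : ℂ) * e z) * C := by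
    rw [← intervalIntegral.integral_mul_const]
    refine intervalIntegral.integral_congr fun z _ => ?_
    ring
  rw [hCout]
  ring

/-- The cosine integral of the kernel for an integer frequency `n ≠ 0`:
`∫₀ᴸ cos(2πnz/L) log|sin(πz/L)| dz = −L/(2|n|)`. [folklore] -/
private theorem integral_cos_int_mul_logKernel {L : ℝ} (hL : 0 < L) {n : ℤ} (hn : n ≠ 0) :
    (∫ z in (0 : ℝ)..L, Real.cos (2 * π * (n : ℝ) * z / L) * Real.log |Real.sin (π * z / L)|) =
      -L / (2 * (n.natAbs : ℝ)) := by
  obtain ⟨m, hm⟩ : ∃ m : ℕ, n.natAbs = m := ⟨_, rfl⟩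
  have hm1 : 1 ≤ m := by
    rw [← hm]
    exact Nat.one_le_iff_ne_zero.2 (Int.natAbs_ne_zero.2 hn)
  have key : (∫ z in (0 : ℝ)..L,
      Real.cos (2 * (m : ℝ) * (π / L * z)) * Real.log |Real.sin (π / L * z)|) = -L / (2 * m) :=
    integral_cos_mode_mul_log_abs_sin hL m hm1
  rw [hm]
  rcases Int.natAbs_eq n with h | h <;> rw [hm] at h <;> subst h
  · rw [← key]
    refine intervalIntegral.integral_congr fun z _ => ?_
    push_cast
    rw [show 2 * π * (m : ℝ) * z / L = 2 * (m : ℝ) * (π / L * z) by ring,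
      show π * z / L = π / L * z by ring]
  · rw [← key]
    refine intervalIntegral.integral_congr fun z _ => ?_
    push_cast
    rw [show 2 * π * (-(m : ℝ)) * z / L = -(2 * (m : ℝ) * (π / L * z)) by ring, Real.cos_neg,
      show π * z / L = π / L * z by ring]

/-- The sine integral of the kernel vanishes for every integer frequency:
`∫₀ᴸ sin(2πnz/L) log|sin(πz/L)| dz = 0`. [folklore] -/
private theorem integral_sin_int_mul_logKernel {L : ℝ} (hL : 0 < L) (n : ℤ) :
    (∫ z in (0 : ℝ)..L, Real.sin (2 * π * (n : ℝ) * z / L) * Real.log |Real.sin (π * z / L)|) =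
      0 := by
  obtain ⟨m, hm⟩ : ∃ m : ℕ, n.natAbs = m := ⟨_, rfl⟩
  have key : (∫ z in (0 : ℝ)..L,
      Real.sin (2 * (m : ℝ) * (π / L * z)) * Real.log |Real.sin (π / L * z)|) = 0 :=
    integral_sin_mode_mul_log_abs_sin hL m
  rcases Int.natAbs_eq n with h | h <;> rw [hm] at h <;> subst h
  · refine Eq.trans ?_ key
    refine intervalIntegral.integral_congr fun z _ => ?_
    push_cast
    rw [show 2 * π * (m : ℝ) * z / L = 2 * (m : ℝ) * (π / L * z) by ring,
      show π * z / L = π / L * z by ring]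
  · have key' : (∫ z in (0 : ℝ)..L,
        -(Real.sin (2 * (m : ℝ) * (π / L * z)) * Real.log |Real.sin (π / L * z)|)) = 0 := by
      rw [intervalIntegral.integral_neg, key, neg_zero]
    refine Eq.trans ?_ key'
    refine intervalIntegral.integral_congr fun z _ => ?_
    push_cast
    rw [show 2 * π * (-(m : ℝ)) * z / L = -(2 * (m : ℝ) * (π / L * z)) by ring, Real.sin_neg,
      show π * z / L = π / L * z by ring, neg_mul]

/-- **The multiplier is `m_n = −L/(2π|n|)` for `n ≠ 0`**: the cosine integral of the kernel is
`∫₀ᴸ cos(2πnz/L) log|sin(πz/L)| dz = −L/(2|n|)` and the sine integral vanishes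
(`…Modes.lean`) — so `ĉ((Qω)′)(n) = (2πin/L) m_n ĉ(ω)(n) = −i sgn(n) ĉ(ω)(n)`, the multiplier of
the periodic Hilbert transform `u_x = Hω`. [cite: ChoiHouKiselevLuoSverakYao2017, §4 p. 11 (eqn_m_hl_u: u_x = Hω, u = Qω)] -/
theorem kernelMultiplier_eq {L : ℝ} (hL : 0 < L) {n : ℤ} (hn : n ≠ 0) :
    (∫ z in (0 : ℝ)..L, (((1 / π * Real.log |Real.sin (π * z / L)|) : ℝ) : ℂ) *
        Complex.exp (((-(2 * π * (n : ℝ) * z / L) : ℝ) : ℂ) * I)) =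
      (((-(L / (2 * π * (n.natAbs : ℝ)))) : ℝ) : ℂ) := by
  -- split the character into cosine and sine
  have hsplit : ∀ z : ℝ, (((1 / π * Real.log |Real.sin (π * z / L)|) : ℝ) : ℂ) *
      Complex.exp (((-(2 * π * (n : ℝ) * z / L) : ℝ) : ℂ) * I) =
      (((1 / π * (Real.cos (2 * π * (n : ℝ) * z / L) * Real.log |Real.sin (π * z / L)|)) : ℝ) : ℂ) -
        (((1 / π * (Real.sin (2 * π * (n : ℝ) * z / L) * Real.log |Real.sin (π * z / L)|)) : ℝ) : ℂ)
          * I := by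
    intro z
    rw [Complex.exp_mul_I, ← Complex.ofReal_cos, ← Complex.ofReal_sin, Real.cos_neg, Real.sin_neg]
    push_cast
    ring
  have hic : IntervalIntegrable
      (fun z => 1 / π * (Real.cos (2 * π * (n : ℝ) * z / L) * Real.log |Real.sin (π * z / L)|))
      volume 0 L := (intervalIntegrable_mul_logKernel (by fun_prop) L).const_mul _
  have his : IntervalIntegrable
      (fun z => 1 / π * (Real.sin (2 * π * (n : ℝ) * z / L) * Real.log |Real.sin (π * z / L)|))
      volume 0 L := (intervalIntegrable_mul_logKernel (by fun_prop) L).const_mul _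
  have hicC : IntervalIntegrable (fun z =>
      (((1 / π * (Real.cos (2 * π * (n : ℝ) * z / L) * Real.log |Real.sin (π * z / L)|)) : ℝ) : ℂ))
      volume 0 L := ⟨hic.1.ofReal, hic.2.ofReal⟩
  have hisC' : IntervalIntegrable (fun z =>
      (((1 / π * (Real.sin (2 * π * (n : ℝ) * z / L) * Real.log |Real.sin (π * z / L)|)) : ℝ) : ℂ))
      volume 0 L := ⟨his.1.ofReal, his.2.ofReal⟩
  have hisC := hisC'.mul_const I
  simp_rw [hsplit]
  rw [intervalIntegral.integral_sub hicC hisC, intervalIntegral.integral_mul_const,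
    intervalIntegral.integral_ofReal, intervalIntegral.integral_ofReal,
    intervalIntegral.integral_const_mul, intervalIntegral.integral_const_mul,
    integral_cos_int_mul_logKernel hL hn, integral_sin_int_mul_logKernel hL n]
  have hm0 : (0 : ℝ) < (n.natAbs : ℝ) := by
    have : 1 ≤ n.natAbs := Nat.one_le_iff_ne_zero.2 (Int.natAbs_ne_zero.2 hn)
    exact_mod_cast this
  push_cast
  field_simp
  ring

/-- **`|m_n| ≤ Λ/π`** for every `n`, `Λ = ∫₀ᴸ |log|sin(πz/L)|| dz` (`|e^{−2πinz/L}| = 1`).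
[cite: ChoiHouKiselevLuoSverakYao2017, §4 p. 11 (eqn_m_hl_u: u = Qω)] -/
theorem norm_kernelMultiplier_le {L : ℝ} (hL : 0 < L) (n : ℤ) :
    ‖∫ z in (0 : ℝ)..L, (((1 / π * Real.log |Real.sin (π * z / L)|) : ℝ) : ℂ) *
        Complex.exp (((-(2 * π * (n : ℝ) * z / L) : ℝ) : ℂ) * I)‖ ≤
      1 / π * ∫ z in (0 : ℝ)..L, |(Real.log |Real.sin (π * z / L)|)| := by
  calc ‖∫ z in (0 : ℝ)..L, (((1 / π * Real.log |Real.sin (π * z / L)|) : ℝ) : ℂ) *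
        Complex.exp (((-(2 * π * (n : ℝ) * z / L) : ℝ) : ℂ) * I)‖
      ≤ ∫ z in (0 : ℝ)..L, ‖(((1 / π * Real.log |Real.sin (π * z / L)|) : ℝ) : ℂ) *
        Complex.exp (((-(2 * π * (n : ℝ) * z / L) : ℝ) : ℂ) * I)‖ :=
        intervalIntegral.norm_integral_le_integral_norm hL.le
    _ = ∫ z in (0 : ℝ)..L, 1 / π * |(Real.log |Real.sin (π * z / L)|)| := by
        refine intervalIntegral.integral_congr fun z _ => ?_
        simp only [norm_mul, Complex.norm_exp_ofReal_mul_I, mul_one, Complex.norm_real,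
          Real.norm_eq_abs, abs_of_pos (show (0 : ℝ) < 1 / π by positivity)]
    _ = 1 / π * ∫ z in (0 : ℝ)..L, |(Real.log |Real.sin (π * z / L)|)| :=
        intervalIntegral.integral_const_mul _ _

/-! ### §4 Parseval: `‖(Qω)′‖₂ ≤ ‖ω‖₂` and `‖Qω‖₂ ≤ (Λ/π)‖ω‖₂` -/

/-- **`u_x = Hω` is an `L²(0,L)`-contraction**: for `L > 0` and an `L`-periodic `ω ∈ C¹(ℝ)`,
`∫₀ᴸ ((Qω)′(x))² dx ≤ ∫₀ᴸ ω(x)² dx`.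
Proof: Parseval on the window for `ω` and for `(Qω)′` (Mathlib `hasSum_sq_fourierCoeffOn`);
mode by mode `ĉ((Qω)′)(n) = (2πin/L)·ĉ(Qω)(n) = (2πin/L)·m_n·ĉ(ω)(n)` with `m_n = −L/(2π|n|)`
for `n ≠ 0` (`|(2πin/L) m_n| = 1`) and `ĉ((Qω)′)(0) = 0`. This is the `L²` isometry of the
periodic Hilbert transform on mean-zero modes — the one non-elementary input of the uniqueness of
smooth periodic HL solutions (§2 p. 6 "(bkmq)"). [cite: ChoiHouKiselevLuoSverakYao2017, §4 p. 11 (eqn_m_hl_u: u_x = Hω) and §2 p. 6 (bkmq)] -/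
theorem integral_sq_deriv_periodicHLVelocity_le {L : ℝ} (hL : 0 < L) {ω : ℝ → ℝ}
    (hω : ContDiff ℝ 1 ω) (hper : Function.Periodic ω L) :
    (∫ x in (0 : ℝ)..L, (deriv (periodicHLVelocity L ω) x) ^ 2) ≤ ∫ x in (0 : ℝ)..L, (ω x) ^ 2 := by
  have hωc : Continuous ω := hω.continuous
  have hperu : Function.Periodic (periodicHLVelocity L ω) L := periodic_periodicHLVelocity hL.ne' ω
  have hu1 : ContDiff ℝ 1 (periodicHLVelocity L ω) :=
    contDiff_periodicHLVelocity hL 1 (by exact_mod_cast hω) hper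
  have hu'c : Continuous (deriv (periodicHLVelocity L ω)) := hu1.continuous_deriv le_rfl
  -- Parseval for `ω` and for `(Qω)′`
  have Pf := hasSum_sq_fourierCoeffOn hL
    (memLp_two_Ioc (f := fun x => ((ω x : ℝ) : ℂ)) (Complex.continuous_ofReal.comp hωc) 0 L)
  have Pg := hasSum_sq_fourierCoeffOn hL
    (memLp_two_Ioc (f := fun x => ((deriv (periodicHLVelocity L ω) x : ℝ) : ℂ))
      (Complex.continuous_ofReal.comp hu'c) 0 L)
  -- termwise comparison
  have hterm : ∀ n : ℤ,
      ‖fourierCoeffOn hL (fun x => ((deriv (periodicHLVelocity L ω) x : ℝ) : ℂ)) n‖ ^ 2 ≤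
        ‖fourierCoeffOn hL (fun x => ((ω x : ℝ) : ℂ)) n‖ ^ 2 := by
    intro n
    rw [fourierCoeffOn_deriv_periodic hL hu1 hperu n, fourierCoeffOn_periodicHLVelocity hL hωc hper n]
    rcases eq_or_ne n 0 with rfl | hn
    · simp only [Int.cast_zero, mul_zero, zero_div, zero_mul, norm_zero]
      rw [zero_pow two_ne_zero]
      positivity
    · rw [kernelMultiplier_eq hL hn, ← mul_assoc, norm_mul, norm_mul]
      have hnR : (n.natAbs : ℝ) = |(n : ℝ)| := by
        rw [Nat.cast_natAbs, Int.cast_abs]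
      have hn0 : (0 : ℝ) < |(n : ℝ)| := abs_pos.2 (by exact_mod_cast hn)
      have hnorm1 : ‖(2 * π * I * n / L : ℂ)‖ = 2 * π * |(n : ℝ)| / L := by
        rw [norm_div, norm_mul, norm_mul, norm_mul, Complex.norm_I, mul_one, Complex.norm_intCast,
          Complex.norm_two, Complex.norm_real, Real.norm_of_nonneg Real.pi_pos.le,
          Complex.norm_real, Real.norm_of_nonneg hL.le]
      have hnorm2 : ‖((((-(L / (2 * π * (n.natAbs : ℝ)))) : ℝ) : ℂ))‖ = L / (2 * π * |(n : ℝ)|) := by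
        rw [Complex.norm_real, Real.norm_eq_abs, abs_neg, hnR, abs_of_pos (by positivity)]
      have hone : ‖(2 * π * I * n / L : ℂ)‖ *
          ‖((((-(L / (2 * π * (n.natAbs : ℝ)))) : ℝ) : ℂ))‖ = 1 := by
        rw [hnorm1, hnorm2]
        field_simp
      rw [hone, one_mul]
  have hle := hasSum_le hterm Pg Pf
  simp only [smul_eq_mul, sub_zero] at hle
  have hg : (∫ x in (0 : ℝ)..L, ‖((deriv (periodicHLVelocity L ω) x : ℝ) : ℂ)‖ ^ 2) =
      ∫ x in (0 : ℝ)..L, (deriv (periodicHLVelocity L ω) x) ^ 2 :=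
    intervalIntegral.integral_congr fun x _ => norm_ofReal_sq _
  have hf : (∫ x in (0 : ℝ)..L, ‖((ω x : ℝ) : ℂ)‖ ^ 2) = ∫ x in (0 : ℝ)..L, (ω x) ^ 2 :=
    intervalIntegral.integral_congr fun x _ => norm_ofReal_sq _
  rw [hg, hf] at hle
  have hLi : 0 < L⁻¹ := inv_pos.2 hL
  exact le_of_mul_le_mul_left hle hLi

/-- **`Q` is `L²(0,L)`-bounded**: for `L > 0` and a continuous `L`-periodic `ω`,
`∫₀ᴸ (Qω(x))² dx ≤ (Λ/π)² ∫₀ᴸ ω(x)² dx`, `Λ = ∫₀ᴸ |log|sin(πz/L)|| dz` (Parseval and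
`|m_n| ≤ Λ/π`). [cite: ChoiHouKiselevLuoSverakYao2017, §4 p. 11 (eqn_m_hl_u: u = Qω) and §2 p. 6 (bkmq)] -/
theorem integral_sq_periodicHLVelocity_le {L : ℝ} (hL : 0 < L) {ω : ℝ → ℝ} (hω : Continuous ω)
    (hper : Function.Periodic ω L) :
    (∫ x in (0 : ℝ)..L, (periodicHLVelocity L ω x) ^ 2) ≤
      (1 / π * ∫ z in (0 : ℝ)..L, |(Real.log |Real.sin (π * z / L)|)|) ^ 2 *
        ∫ x in (0 : ℝ)..L, (ω x) ^ 2 := by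
  set Λ' : ℝ := 1 / π * ∫ z in (0 : ℝ)..L, |(Real.log |Real.sin (π * z / L)|)| with hΛ'
  have hΛ0 : 0 ≤ Λ' := by
    rw [hΛ']
    exact mul_nonneg (by positivity)
      (intervalIntegral.integral_nonneg hL.le fun z _ => abs_nonneg _)
  have huc : Continuous (periodicHLVelocity L ω) := continuous_periodicHLVelocity hL hω hper
  have Pf := hasSum_sq_fourierCoeffOn hL
    (memLp_two_Ioc (f := fun x => ((ω x : ℝ) : ℂ)) (Complex.continuous_ofReal.comp hω) 0 L)
  have Pg := hasSum_sq_fourierCoeffOn hL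
    (memLp_two_Ioc (f := fun x => ((periodicHLVelocity L ω x : ℝ) : ℂ))
      (Complex.continuous_ofReal.comp huc) 0 L)
  have hterm : ∀ n : ℤ,
      ‖fourierCoeffOn hL (fun x => ((periodicHLVelocity L ω x : ℝ) : ℂ)) n‖ ^ 2 ≤
        Λ' ^ 2 * ‖fourierCoeffOn hL (fun x => ((ω x : ℝ) : ℂ)) n‖ ^ 2 := by
    intro n
    rw [fourierCoeffOn_periodicHLVelocity hL hω hper n, norm_mul, mul_pow]
    gcongr
    exact norm_kernelMultiplier_le hL n
  have hle := hasSum_le hterm Pg (Pf.mul_left (Λ' ^ 2))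
  simp only [smul_eq_mul, sub_zero] at hle
  have hg : (∫ x in (0 : ℝ)..L, ‖((periodicHLVelocity L ω x : ℝ) : ℂ)‖ ^ 2) =
      ∫ x in (0 : ℝ)..L, (periodicHLVelocity L ω x) ^ 2 :=
    intervalIntegral.integral_congr fun x _ => norm_ofReal_sq _
  have hf : (∫ x in (0 : ℝ)..L, ‖((ω x : ℝ) : ℂ)‖ ^ 2) = ∫ x in (0 : ℝ)..L, (ω x) ^ 2 :=
    intervalIntegral.integral_congr fun x _ => norm_ofReal_sq _
  rw [hg, hf] at hle
  have hLi : 0 < L⁻¹ := inv_pos.2 hL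
  rw [show Λ' ^ 2 * (L⁻¹ * ∫ x in (0 : ℝ)..L, (ω x) ^ 2) =
    L⁻¹ * (Λ' ^ 2 * ∫ x in (0 : ℝ)..L, (ω x) ^ 2) by ring] at hle
  exact le_of_mul_le_mul_left hle hLi

end ChoiEtAl2017

end Literature.Analysis.FluidPDE
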